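import Summits.RiemannHypothesis.RiemannHypothesis.Theorems.TiltedLandingLaw421R3Lens1Pinning

/-! # WindowBooks-v6 r2 — «FLOOR BOOKS»: the band-lowest depth law FLOOR, the lift law, the purse fit, and the (K) converter to the rate half; r2 adds §4,
the T0 triple's FIT⁗ closed by budget arithmetic on tall frames (`6s ≤ Hs`) down to the SMALL-FRAME root-tent law (director (CA861) «T½ vs T0 PENDING-BENCH»)
(v6 = the FLOOR-FORM image of v5 6200fc106c95fcab after director-rh g28 (CA857)(4) «floor form for the registered stub; the tracker stays a proof device in
the Cruxes workfiles»; lens-2 g10; RSV-80 candidate; constants of record (CA857): (c, aH, aY) = (1/2, halfBudget, halfBudget); NO tracker in this file)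

**Why the floor form (v5 → v6).**  v5 typed the depth law on tracked LINEAGES (`SurvivorLawQ c aH`: every survivor `w ∈ popQ k` has depth
`η²(Hs² − Im w²)/s² ≥ c·k − aH`).  For ANY seeding, `popQ k ⊆` band states and the band-LOWEST `v_k` satisfies `Im v_k ≤ Im w` for every band state `w`
(`IsLowest`.2), so `depth v_k ≥ depth w`: SURV ∧ `popQ k ≠ ∅` ⇒ FLOOR at every charged `k`, and `Charged` hands the converter `v_k` directly.  Hence
FLOOR (below) is WEAKER than every lineage form, feeds the SAME converter with no tracker, and every kill of FLOOR kills SURV — not conversely (crit-1 g7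
R4-KILLER-1: HOVER-100 killed SURV-T2, HOVER-seed killed SURV-(s1), «R4′ (band-lowest form) SURVIVES both»; instr-1 g10 (c2): c_maxL ≥ 1.018 at aH = 0).
Lineages remain the PROOF MECHANISM (FLOOR is not inductive — the lowest swaps; `depth_mono_of_isHeirQ` + a per-step gain is): tracker T2′ and
`SurvivorLawQ` live on in the workfile `Lens2_WindowBooks_v5.lean` (c48f9bd2fa7f), and (K) «SURV-(s1) ⇒ FLOOR» is filed there after this image lands.

**LAWS (§1, typed OPEN bench items).**  ★ FLOOR `FloorLawQ c aH`: at every charged level `k` the band-LOWEST state `v` lies at energy depth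
`η²(Hs² − Im v²)/s² ≥ c·k − aH` below the ceiling `Hs` (form `c·k`; a seed may sit AT `Im = Hs` when `hmax = Hs`, depth 0).  Mechanism (located content,
not a bare cap): an unlifted isolated zero dissipates `(η/(s·g_eff))² ≥ 1` energy units per level inside the box (`|g_eff| ≤ η/s`, clause 16), a lateral
entrant at level `k` has drifted `k/|g|` and sunk accordingly, an in-band lifter above height `y` passes below `y` within `depth(y)` levels, there is no
lifter above the ceiling (clause 9), and a HOVERING multiple / clustered zero (its own heir at constant height for `M − 1 ≤ B` levels, `HalfSlabBudget`) costs
`c·(M − 1) ≤ B/2 < halfBudget` at `c = 1/2` — hence `aH = halfBudget` ((CA857); at `aH = budgetConst 0` the lineage forms are DEAD by R4-KILLER-1, the floor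
form survived the two hover designs because the EMITTED zero below a hovering cluster is the lowest and deepens).  BENCH (instr-1 g10 E13.4.9–11, floats):
c = 1 is candidate-false (XS rows sink at .9926/level), c = 1/2 clears every legal-charged row in both forms; constants of record (1/2, halfBudget).
★ LIFT `ChargedLiftLawQ aY` (v3/v5 VERBATIM; signed cumulative charged change of the lowest band height ≥ −aY·s/4; `aY = halfBudget`).
FIT⁗ `PurseFitQ c aH aY` (v5 VERBATIM): `(η²Hs²/s² + aH)/c + 1 + aY ≤ slackPQ halfPurse` per legal charged frame.  WHAT FIT⁗ IS ((CA857)(1), §2):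
with `slackPQ halfPurse = (Hs/s)² + B + 1 + 4(hmax − lowH 0)/s − T₀ + (B+1)/2` (K `slackPQ_halfPurse_eq`; `T₀ = tentMeterTrkD (3/2) … 0` = the root's companion
count in the strip `|Re z − Re u| ≤ (3/2)·Im u`), at (1/2, halfBudget, halfBudget) both budget terms cancel and FIT⁗ ⟺ `RootTentHalfQ` (K
`purseFitQ_half_iff_rootTent`): «every legal frame with a charged level has `T₀ + 1 + 2η²Hs²/s² ≤ (Hs/s)² + 4(hmax − lowH 0)/s`» — a ROOT-TENT LAW, level-0
located, B-free.  It is NOT provable from `EngineHyps5` and the tree: INIT♯ (`initSharpQ_closed` ⇒ `slack0Q_nonneg`) gives only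
`T₀ ≤ (Hs/s)² + B + 1 + 4(hmax − rootHeight)/s`, and `ColumnBudgetMult` at `r = (3/2)·lowH 0` only `T₀ ≤ B + 3·lowH 0/s − 2`; the content is dynamical
(«a root tent larger than (1 − 2η²)P + 4Δh/s − 1 forces `TiltReady 0 ∨ WindowReady 0`, hence — Ready being cumulative — no charged level») and OPEN.

**KERNEL (§3, K, sorry-free).**  `restRateBotPQ_of_floor : 0 < c → FLOOR → LIFT → FIT⁗ → RestRateBotPQ halfPurse` (the `Charged` witness IS the lowest;
drop `Im v²`, divide by `c`: `k ≤ (η²Hs²/s² + aH)/c`; count ≤ k+1; signed charged drops ≥ −aY; credits ≥ 0) — it replaces the binder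
`hR : RhW08.RateSplit.RateLawsHalfQ` of `RhW08.Lens1Coverage.TiltedLandingLaw421R_of_regHungCut10S` exactly as v3/v5 did; read-back `law421R_of_floor`
concludes the crux decl `…Theses.EarlyAppointments.TiltedLandingLaw421R` BY NAME from `TopPinning`, `RegUmbrella11S` and the three laws.
IMAGE CANDIDATE, registry-neutral: the skeleton OF RECORD stays `Lines/trkD_v11q.lean` e5f3c2cea72a0413; nothing here is a registry stub.  ONE TREE import
`…R3Lens1Pinning`.  HONEST LABEL: FLOOR, LIFT, FIT⁗ (⟺ RootTentHalfQ at the constants of record) are OPEN; only §2/§3 are K.  Nothing here bears on the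
truth of RH; RH is not proved; 33346/33347 OPEN; checked ≠ landed ≠ proved. -/

namespace RhW08.TrackedWindow

open Complex
open RhW08.Round1 RhW08.StSwap RhW08.Round2 RhW08.QuadW RhW08.SealSwapQ RhW08.PurseP RhIdea6.G17.W07C7 RhIdea6.G17.W07C7.Rev6
open RhW08.SealSwap (PBot)
open RhIdea6.G18.W07C8.Law421BirthS RhIdea6.G19.W07C11.Seam RhIdea6.G20.W07C12.Frac RhIdea6.G20.W07C12.StColP RhW07.C12.FieldSplit RhW07.C14.TwoSided RhW07.C14.Classes

/-! ## §1 The laws (typed OPEN bench items) -/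

/-- ★ FLOOR — **BAND-LOWEST DEPTH LAW** (OPEN): at every charged level `k`, the band-lowest state `v` (the `Charged` witness, tree `IsLowest StTrkDQ`) lies at
energy depth `≥ c·k − aH` below the ceiling: `c·k ≤ η²(Hs² − Im v²)/s² + aH`.  Constants of record (CA857): `c = 1/2` (bench c_max = .9925 — NEVER type
`c = 1`), `aH = halfBudget` (hover of a multiple / clustered zero costs `c·(M − 1) ≤ B/2`).  Weaker than every lineage form `SurvivorLawQ c aH` (v5). -/
def FloorLawQ (c : ℝ) (aH : Budget) : Prop :=
  ∀ (η : ℝ) (f : ℂ → ℂ) (x₀ s hmax R Hs : ℝ) (B : ℕ), EngineHyps5 2 η f x₀ s hmax R Hs B →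
    ∀ k : ℕ, Charged (PTrkSQ PBot) StTrkDQ ReadyR2 η f x₀ s hmax R Hs B k →
      ∀ v : ℂ, IsLowest StTrkDQ η f x₀ s hmax R Hs B k v → c * (k : ℝ) ≤ η ^ 2 * (Hs ^ 2 - v.im ^ 2) / s ^ 2 + aH η f x₀ s hmax R Hs B

/-- ★ LIFT — **CHARGED LIFT LAW** (OPEN; v3/v5 VERBATIM; HEIGHT currency, signed and cumulative): the charged levels below a charged level never raise the lowest
band height by more than `aY·s/4` in aggregate, i.e. `−aY ≤ chargedDropSumQ (k+1)`.  Constant of record: `aY = halfBudget`. -/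
def ChargedLiftLawQ (aY : Budget) : Prop :=
  ∀ (η : ℝ) (f : ℂ → ℂ) (x₀ s hmax R Hs : ℝ) (B : ℕ), EngineHyps5 2 η f x₀ s hmax R Hs B →
    ∀ k : ℕ, Charged (PTrkSQ PBot) StTrkDQ ReadyR2 η f x₀ s hmax R Hs B k →
      - aY η f x₀ s hmax R Hs B ≤ chargedDropSumQ η f x₀ s hmax R Hs B (k + 1)

/-- FIT⁗ — **THE PURSE INEQUALITY** (OPEN; v5 VERBATIM, closed form per legal charged frame): the ceiling horizon `(η²Hs²/s² + aH)/c`, one level, and the lift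
allowance fit in the level-0 slack of the ½-purse: `(η²Hs²/s² + aH)/c + 1 + aY ≤ slackPQ halfPurse`.  At the constants of record it IS the root-tent law
`RootTentHalfQ` (K `purseFitQ_half_iff_rootTent`, §2) — NOT derivable from `EngineHyps5`. -/
def PurseFitQ (c : ℝ) (aH aY : Budget) : Prop :=
  ∀ (η : ℝ) (f : ℂ → ℂ) (x₀ s hmax R Hs : ℝ) (B : ℕ), EngineHyps5 2 η f x₀ s hmax R Hs B →
    ∀ k : ℕ, Charged (PTrkSQ PBot) StTrkDQ ReadyR2 η f x₀ s hmax R Hs B k →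
      (η ^ 2 * Hs ^ 2 / s ^ 2 + aH η f x₀ s hmax R Hs B) / c + 1 + aY η f x₀ s hmax R Hs B ≤ slackPQ halfPurse η f x₀ s hmax R Hs B

/-- **ROOT-TENT LAW at the ½-constants** (OPEN; the unfolded content of `PurseFitQ (1/2) halfBudget halfBudget`, B-free and level-0 located): on every legal frame
with a charged level, the root's companion count `T₀ = tentMeterTrkD (3/2) … 0`, one level and the sinking budget `2η²Hs²/s²` fit in the energy purse plus the
root's clearance: `T₀ + 1 + 2η²Hs²/s² ≤ (Hs/s)² + 4(hmax − lowH 0)/s`. -/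
def RootTentHalfQ : Prop :=
  ∀ (η : ℝ) (f : ℂ → ℂ) (x₀ s hmax R Hs : ℝ) (B : ℕ), EngineHyps5 2 η f x₀ s hmax R Hs B →
    ∀ k : ℕ, Charged (PTrkSQ PBot) StTrkDQ ReadyR2 η f x₀ s hmax R Hs B k →
      tentMeterTrkD (3 / 2) η f x₀ s hmax R Hs B 0 + 1 + 2 * (η ^ 2 * Hs ^ 2 / s ^ 2)
        ≤ (Hs / s) ^ 2 + 4 * (hmax - lowH StTrkDQ η f x₀ s hmax R Hs B 0) / s

/-! ## §2 (K) bookkeeping and the closed form of the ½-slack -/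

open Classical in
/-- (K) bookkeeping: at most `k` charged levels below `k`. -/
theorem chargeCount_le_levelQ (P St Ready : StatePred) (η : ℝ) (f : ℂ → ℂ) (x₀ s hmax R Hs : ℝ) (B k : ℕ) :
    chargeCount P St Ready η f x₀ s hmax R Hs B k ≤ (k : ℝ) := by
  unfold chargeCount
  have h : ∀ j ∈ Finset.range k, (if Charged P St Ready η f x₀ s hmax R Hs B j then (1 : ℝ) else 0) ≤ 1 := fun j _ => by split_ifs <;> norm_num
  exact (Finset.sum_le_sum h).trans (by simp)

/-- (K) the ½-slack in closed form: `slackPQ halfPurse = (Hs/s)² + B + 1 + 4(hmax − lowH 0)/s − T₀ + (B+1)/2` (tree `slack0Q_eq` + the ½ extra capital). -/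
theorem slackPQ_halfPurse_eq (η : ℝ) (f : ℂ → ℂ) (x₀ s hmax R Hs : ℝ) (B : ℕ) :
    slackPQ halfPurse η f x₀ s hmax R Hs B = (Hs / s) ^ 2 + (B : ℝ) + 1
      + 4 * (hmax - lowH StTrkDQ η f x₀ s hmax R Hs B 0) / s - tentMeterTrkD (3 / 2) η f x₀ s hmax R Hs B 0 + ((B : ℝ) + 1) / 2 := by
  have h0 : slackPQ halfPurse η f x₀ s hmax R Hs B = slack0Q η f x₀ s hmax R Hs B + ((B : ℝ) + 1) / 2 := by
    simp only [slackPQ, slack0Q, halfPurse]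
    ring
  rw [h0, slack0Q_eq]

/-- ★ (K) **FIT⁗ at the constants of record IS the root-tent law**: `PurseFitQ (1/2) halfBudget halfBudget ↔ RootTentHalfQ` (both budget terms cancel against
`slack0Q`'s native `B + 1` and the ½-purse's extra `(B+1)/2`). -/
theorem purseFitQ_half_iff_rootTent : PurseFitQ (1 / 2) halfBudget halfBudget ↔ RootTentHalfQ := by
  constructor
  · intro h η f x₀ s hmax R Hs B hE k hk
    have h1 := h η f x₀ s hmax R Hs B hE k hk
    rw [slackPQ_halfPurse_eq] at h1
    simp only [halfBudget, div_div_eq_mul_div, div_one] at h1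
    linarith
  · intro h η f x₀ s hmax R Hs B hE k hk
    have h1 := h η f x₀ s hmax R Hs B hE k hk
    rw [slackPQ_halfPurse_eq]
    simp only [halfBudget, div_div_eq_mul_div, div_one]
    linarith

/-! ## §3 (K) THE CONVERTER: FLOOR + LIFT + FIT⁗ ⇒ the rate half at the ½-purse -/

/-- ★★★ (K) **THE FLOOR-BOOKS CONVERTER** — `0 < c → FLOOR → LIFT → FIT⁗ → RestRateBotPQ halfPurse`.
At a charged `k` the `Charged` witness `v` IS the band-lowest state; FLOOR and `Im v² ≥ 0` give `c·k ≤ η²Hs²/s² + aH`, so `k ≤ (η²Hs²/s² + aH)/c`, and FIT⁗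
gives `k + 1 ≤ slack_½ − aY`; then `netCost_all (k+1) = chargeCount (k+1) − chargedDropSum (k+1) ≤ (k+1) + aY ≤ slack_½ ≤ slack_½ + credits (k+1)` — the
step form `restRateBotPQ_iff_books_step halfPurse` (INIT from `typedPurse ≤ halfPurse`). -/
theorem restRateBotPQ_of_floor {c : ℝ} {aH aY : Budget} (hc : 0 < c) (hF : FloorLawQ c aH)
    (hY : ChargedLiftLawQ aY) (hfit : PurseFitQ c aH aY) : RestRateBotPQ halfPurse := by
  rw [restRateBotPQ_iff_books_step]
  intro η f x₀ s hmax R Hs B hE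
  refine ⟨slackPQ_nonneg_of_typed_le hE (typedPurse_le_halfPurse f x₀ s hmax R Hs B), fun k hk => ?_⟩
  obtain ⟨v, hlow, -, -⟩ := id hk
  have hFk := hF η f x₀ s hmax R Hs B hE k hk v hlow
  have hYk := hY η f x₀ s hmax R Hs B hE k hk
  have hfitk := hfit η f x₀ s hmax R Hs B hE k hk
  -- (1) drop the lowest state's own height: depth ≤ the full ceiling horizon
  have h1 : η ^ 2 * (Hs ^ 2 - v.im ^ 2) / s ^ 2 ≤ η ^ 2 * Hs ^ 2 / s ^ 2 :=
    div_le_div_of_nonneg_right (mul_le_mul_of_nonneg_left (by nlinarith [sq_nonneg v.im]) (sq_nonneg η)) (sq_nonneg s)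
  -- (2) FLOOR ⇒ `k ≤ (η²Hs²/s² + aH)/c`
  have hk1 : (k : ℝ) ≤ (η ^ 2 * Hs ^ 2 / s ^ 2 + aH η f x₀ s hmax R Hs B) / c := by
    rw [le_div_iff₀ hc]
    linarith
  -- (3) the books: count ≤ k+1, the signed charged drops ≥ −aY, credits ≥ 0, FIT⁗
  have hcount := chargeCount_le_levelQ (PTrkSQ PBot) StTrkDQ ReadyR2 η f x₀ s hmax R Hs B (k + 1)
  push_cast at hcount
  have hcr := creditsQ_nonneg η f x₀ s hmax R Hs B (k + 1)
  rw [netCostQ_all_eq]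
  linarith

/-- ★★ READ-BACK (K modulo the NAMED hypotheses): the CRUX DECL BY NAME from the two registry SUCC stubs (`TopPinning`, `RegUmbrella11S`, shared with v11q)
and the three floor-books laws — `restRateBotPQ_of_floor` sits exactly where `RhW08.RateSplit.restRateBotPQ_half_of_rateLaws hR` sat. -/
theorem law421R_of_floor {c : ℝ} {aH aY : Budget} (hP : RhW08.Lens1Pinning.TopPinning) (hU : RhW08.Lens1Pinning.RegUmbrella11S)
    (hc : 0 < c) (hF : FloorLawQ c aH) (hY : ChargedLiftLawQ aY) (hfit : PurseFitQ c aH aY) :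
    Summit.RiemannHypothesis.RiemannHypothesis.Theses.EarlyAppointments.TiltedLandingLaw421R :=
  law421Half_of_succ_rate (RhW08.Lens1Coverage.restSuccBotQ_of_resS
      (RhW08.Lens1Coverage.regRes8S_of_regHungCut10S (RhW08.Lens1Pinning.regHungCut10S_of_topPinning hP hU)))
    (restRateBotPQ_of_floor hc hF hY hfit)

/-- (K) the same at the rate of record `c = 1/2` (`aH`, `aY` stay parameters — of record `halfBudget` both, (CA857)), the scalar side-condition discharged. -/
theorem law421R_of_floor_half {aH aY : Budget} (hP : RhW08.Lens1Pinning.TopPinning) (hU : RhW08.Lens1Pinning.RegUmbrella11S)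
    (hF : FloorLawQ (1 / 2) aH) (hY : ChargedLiftLawQ aY) (hfit : PurseFitQ (1 / 2) aH aY) :
    Summit.RiemannHypothesis.RiemannHypothesis.Theses.EarlyAppointments.TiltedLandingLaw421R :=
  law421R_of_floor hP hU one_half_pos hF hY hfit

/-- (K) … and at the FULL triple of record, with FIT⁗ supplied in its root-tent form. -/
theorem law421R_of_floor_rootTent (hP : RhW08.Lens1Pinning.TopPinning) (hU : RhW08.Lens1Pinning.RegUmbrella11S)
    (hF : FloorLawQ (1 / 2) halfBudget) (hY : ChargedLiftLawQ halfBudget) (hT : RootTentHalfQ) :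
    Summit.RiemannHypothesis.RiemannHypothesis.Theses.EarlyAppointments.TiltedLandingLaw421R :=
  law421R_of_floor_half hP hU hF hY (purseFitQ_half_iff_rootTent.2 hT)

/-! ## §4 The T0 triple (1/2, budgetConst 0, halfBudget): FIT⁗ is budget arithmetic on TALL frames (`6s ≤ Hs`); the residue is a SMALL-FRAME root-tent law -/

open RhIdea6.G20.W07C13pre.Tent RhIdea6.G21.W07C13.TentMax in
/-- (K) **the root tent against the column budget** (the tree's INIT♯ per column state, `RhW08.Round2.tentAt_column_le_purse`, stopped one step earlier):
`T₀ ≤ B + max 2 (3·Hs/s) − 2` on every legal frame (pair bookkeeping `tentCount + 2 ≤ stripCount` in the strip of radius `max s ((3/2)·Im u)`, then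
`ColumnBudgetMult`; the lowest level-0 state has `Im u ≤ Hs`). -/
theorem tentMeterTrkD_zero_le_strip {η : ℝ} {f : ℂ → ℂ} {x₀ s hmax R Hs : ℝ} {B : ℕ} (hE : EngineHyps5 2 η f x₀ s hmax R Hs B) :
    tentMeterTrkD (3 / 2) η f x₀ s hmax R Hs B 0 ≤ (B : ℝ) + max 2 (3 * Hs / s) - 2 := by
  have hroot : rootHeight StTrkD η f x₀ s hmax R Hs B ≤ hmax := rootHeight_stTrkD_le_hmax hE
  obtain ⟨hdiff, hreal, -, hs, hCs, hChm, h3hm, -, hband, hCHs, -, hCB, -⟩ := id hE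
  unfold tentMeterTrkD
  apply Real.sSup_le
  · rintro _ ⟨u, hu, rfl⟩
    have hcol := stCol'_re_of_stTrkD_zero hu.1
    have hh : u.im ≤ hmax := by rw [im_eq_rootHeight_of_isLowest_zero hu]; exact hroot
    have hre : u.re = x₀ := hcol.2
    obtain ⟨hf0, hu0, huim, -, huHs⟩ := hcol.1
    simp only [iteratedDeriv_zero] at hf0 hu0
    simp only [tentAt, iteratedDeriv_zero]
    set r : ℝ := max s (3 / 2 * u.im) with hr
    have hsr : s ≤ r := le_max_left _ _
    have hrR : r ≤ R := by
      apply max_le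
      · nlinarith
      · nlinarith
    have hT : tentCount f u.re (3 / 2 * u.im) u + 2 ≤ stripCount f x₀ r := by
      refine tentCount_add_two_le_stripCount hdiff hf0 hreal hband hu0 huim ?_ ?_
      · intro z hz
        rw [hre] at hz
        exact hz.trans (le_max_right _ _)
      · rw [hre, sub_self, abs_zero]
        exact hs.le.trans hsr
    have hbud : stripCount f x₀ r - 2 * r / s ≤ B := hCB r hsr hrR
    have h2r : 2 * r / s ≤ max 2 (3 * Hs / s) := by
      rcases le_total (3 / 2 * u.im) s with hcase | hcase
      · have hrs : r = s := by rw [hr]; exact max_eq_left hcase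
        rw [hrs, show 2 * s / s = 2 by field_simp]
        exact le_max_left _ _
      · have hru : r = 3 / 2 * u.im := by rw [hr]; exact max_eq_right hcase
        rw [hru]
        have : 2 * (3 / 2 * u.im) / s ≤ 3 * Hs / s := div_le_div_of_nonneg_right (by nlinarith) hs.le
        exact this.trans (le_max_right _ _)
    linarith
  · have : (2 : ℝ) ≤ max 2 (3 * Hs / s) := le_max_left _ _
    have hB : (0 : ℝ) ≤ B := Nat.cast_nonneg B
    linarith

/-- **SMALL-FRAME ROOT-TENT LAW** (OPEN residue of FIT⁗ at the T0 triple; frames with `Hs < 6s` ONLY, i.e. energy purse `(Hs/s)² < 36`): on such a legal frame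
with a charged level, `T₀ + 2η²Hs²/s² ≤ (Hs/s)² + B + 4(hmax − lowH 0)/s`.  Budget arithmetic cannot close it (a budget-saturating ROW at the ceiling realises
`T₀ = B + 3·lowH 0/s − 2`); its content is dynamical («a dense ceiling row never stalls»). -/
def RootTentSmallQ : Prop :=
  ∀ (η : ℝ) (f : ℂ → ℂ) (x₀ s hmax R Hs : ℝ) (B : ℕ), EngineHyps5 2 η f x₀ s hmax R Hs B → Hs < 6 * s →
    ∀ k : ℕ, Charged (PTrkSQ PBot) StTrkDQ ReadyR2 η f x₀ s hmax R Hs B k →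
      tentMeterTrkD (3 / 2) η f x₀ s hmax R Hs B 0 + 2 * (η ^ 2 * Hs ^ 2 / s ^ 2)
        ≤ (Hs / s) ^ 2 + (B : ℝ) + 4 * (hmax - lowH StTrkDQ η f x₀ s hmax R Hs B 0) / s

/-- ★ (K) **FIT⁗ AT THE T0 TRIPLE IS ARITHMETIC ON TALL FRAMES**: `RootTentSmallQ → PurseFitQ (1/2) (budgetConst 0) halfBudget`.  On a frame with `6s ≤ Hs`:
`T₀ ≤ B + 3Hs/s − 2` (`tentMeterTrkD_zero_le_strip`), `3Hs/s ≤ (Hs/s)²/2`, `2η² ≤ 1/2` (clause `2η ≤ 1`) and `lowH 0 ≤ hmax` give the fit with `2` to spare;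
on a frame with `Hs < 6s` it is the hypothesis. -/
theorem purseFitQ_T0_of_small (hS : RootTentSmallQ) : PurseFitQ (1 / 2) (budgetConst 0) halfBudget := by
  intro η f x₀ s hmax R Hs B hE k hk
  obtain ⟨-, -, -, hs, -, -, -, -, -, -, -, -, -, hη0, hη1, -⟩ := id hE
  have hL : lowH StTrkDQ η f x₀ s hmax R Hs B 0 ≤ hmax := by
    rw [lowH_zero]; exact (rootHeight_stTrkDQ_le hE).trans (rootHeight_stTrkD_le_hmax hE)
  have hLs : 0 ≤ 4 * (hmax - lowH StTrkDQ η f x₀ s hmax R Hs B 0) / s := div_nonneg (by linarith) hs.le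
  have hEq : η ^ 2 * Hs ^ 2 / s ^ 2 = η ^ 2 * (Hs / s) ^ 2 := by rw [div_pow]; ring
  have hη2 : η ^ 2 ≤ 1 / 4 := by nlinarith
  rw [slackPQ_halfPurse_eq]
  simp only [halfBudget, budgetConst, div_div_eq_mul_div, div_one, add_zero]
  by_cases hsm : Hs < 6 * s
  · have h := hS η f x₀ s hmax R Hs B hE hsm k hk
    linarith
  · have hsm' : 6 * s ≤ Hs := not_lt.1 hsm
    have ht6 : 6 ≤ Hs / s := by rw [le_div_iff₀ hs]; linarith
    have hT0 := tentMeterTrkD_zero_le_strip hE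
    have hmx : max 2 (3 * Hs / s) = 3 * (Hs / s) := by
      rw [mul_div_assoc]; exact max_eq_right (by linarith)
    rw [hmx] at hT0
    have h3t : 3 * (Hs / s) ≤ (Hs / s) ^ 2 / 2 := by nlinarith
    have h2E : 2 * (η ^ 2 * (Hs / s) ^ 2) ≤ (Hs / s) ^ 2 / 2 := by nlinarith [sq_nonneg (Hs / s)]
    rw [hEq]
    linarith

/-- (K) READ-BACK at the T0 triple: the crux BY NAME from pinning, FLOOR(1/2, budgetConst 0), LIFT(halfBudget) and the SMALL-FRAME root-tent law only. -/
theorem law421R_of_floor_T0 (hP : RhW08.Lens1Pinning.TopPinning) (hU : RhW08.Lens1Pinning.RegUmbrella11S)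
    (hF : FloorLawQ (1 / 2) (budgetConst 0)) (hY : ChargedLiftLawQ halfBudget) (hS : RootTentSmallQ) :
    Summit.RiemannHypothesis.RiemannHypothesis.Theses.EarlyAppointments.TiltedLandingLaw421R :=
  law421R_of_floor_half hP hU hF hY (purseFitQ_T0_of_small hS)

end RhW08.TrackedWindow
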